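import Summits.Ventures.CertifiedArithmetic.LowPrec.RoundEqualPrecision
import Summits.Ventures.CertifiedArithmetic.LowPrec.DoubleRoundingSqrtMatrix

/-!
# THEOREM E-sqrt — equal precision: a square root through a format of the same precision

HONEST FRAMING (venture CertifiedArithmetic / cell `pub-lowprec`): certified error envelopes and
provably optimal rounding/accumulation schemes for low-precision formats under stated cost models;
every table by two implementations; no hardware or vendor claims.

`DRSqrt X Y` (`RoundSqrt.lean`): for every value `a ≥ 0` of `X`, ONE correctly rounded square
root executed in `Y` and converted to `X` is the correctly rounded square root of `X` (saturating
round-to-nearest-even, subnormals kept). THEOREM D-sqrt (`DoubleRoundingSqrtMatrix.lean`) decided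
the `13 × 13` named matrix by the parameter test `drSqrtTest` ((I) identical ∨ (G) same grid,
larger top ∨ (S) the square-root clause `P_Y ≥ 2 P_X + 2 ∧ …`), one witness per failing cell, and
— for THIRTEEN innocuous cells of EQUAL precision that no clause covered (`drSqrtExhPairs`: e4m3 ↔
binary8p4 ↔ binary8p4f, e5m2 ↔ binary8p3 ↔ binary8p3f minus the two (G) cells, e3m2 → e5m2 /
binary8p3 / binary8p3f; nine of them not even embeddings) — EXHAUSTION of the source format in
the kernel. This file replaces the exhaustion by a record-generic LAW:

THEOREM E-sqrt (`drSqrt_of_equal_precision`). If `m_X = m_Y = m ≥ 1`,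
`2 (m + L_X) ≤ L_X`, `2 (m + L_Y) ≤ L_X` (the root of the smallest positive value `2^{L_X}` of `X`
is a NORMAL number of both formats), `1 < M_X` and `M_X < M_Y²` (no root reaches a top), then
`DRSqrt X Y` — whatever the biases and tops, and with no inclusion between the value sets.
PROOF: both correctly rounded roots are the RNE, in `Y` and in `X`, of ONE rational — the
half-quantum surrogate of `√a` in the finer of the two formats (transfer lemma
`toRat_roundNE_sqrtSurr`, `RoundSqrt.lean`) — and that surrogate lies in the common normal band
`[max 2^m q, min M]` (§1: `(2^m q)² ≤ q_X ≤ a` forces `2^m q` below the root's cell, and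
`(h ν)² ≤ a ≤ M_X < M²` keeps the cell `[h ν, (h+1) ν)` below the top `M`, a multiple of `ν`),
where the BAND LEMMA's corollary `toRat_roundNE_roundNE_of_manBits_eq_band`
(`RoundEqualPrecision.lean`) gives `fl_X (fl_Y x) = fl_X x`.

THE NAMED MATRIX WITHOUT EXHAUSTION (§3): the boolean `drSqrtEqTest` holds on `25` named cells —
the `13` exhaustion cells, the `2` (G) cells and the `10` diagonal cells with `bias ≥ m + 1` — so
`drSqrtPairs = filter (drSqrtTest ∨ drSqrtEqTest)` over the `169` cells
(`drSqrtPairs_eq_filter_tests`) and `DRSqrt X Y ↔ drSqrtTest X Y ∨ drSqrtEqTest X Y`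
(`drSqrt_named_iff_tests`; the `←` direction is now two parameter laws, the `→` direction the
witness table); among the `24` off-diagonal named pairs of equal precision, `DRSqrt ↔
drSqrtEqTest` (`drSqrt_named_equal_precision_iff`: `15` hold, the `9` others — e5m2 / binary8p3 /
binary8p3f → e3m2 and e2m3 ↔ e4m3 / binary8p4 / binary8p4f — violate an underflow hypothesis and
fail). §4: each of the three range hypotheses is violated ALONE by a failing cell (kernel
witnesses); binary16's roots are correctly emulated through the 19-bit record
`⟨10, 127, 254, 1023⟩` (binary16's precision behind an 8-bit exponent field) but not conversely.

TWO IMPLEMENTATIONS: A = `code/enum/sqrt_equal_law.py` → `certs/enum/DOUBLE-ROUNDING-SQRT-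
EQUAL.json` (Part 2: `12288` ordered pairs of pseudo-records of equal `m ∈ {1,2,3}`, the test
evaluated as stated here and `DRSqrt` by brute force over every nonnegative operand with two
independent exact RNE square roots — `335` test-true pairs, `0` violations, `280576` operands;
Part 3: the `25` named test cells = `drSqrtExhPairs ∪ (G) ∪ diagonal(bias ≥ m+1)`, each
innocuous in `DOUBLE-ROUNDING-SQRT.json`, the `54`-cell matrix = the filter, the `24`
equal-precision pairs, binary16 through `⟨10, 127, 254, 1023⟩` by brute force over its `31744`
nonnegative values and the converse witness); B = the kernel (this file). PLACEMENT: through a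
register of the SAME precision and WIDER exponent range only products and quotients can slip
(at underflow), square roots cannot — folklore of x87 precision control (Golliver's
store-reload, as reported by Shudo–Muraoka 2000 §3.2, lit key `paper:galaxy-pdf-
6957003653025018000`); innocuous double rounding of `√` for `p₂ ≥ 2 p₁ + 2` [Figueroa1995;
Roux2014, Thm 25]; formats of equal precision coincide on the normal range [BoldoMelquiond2017,
§3.1.3.4]. NEW: the record-generic test with its exact underflow/top hypotheses for finite
saturating formats, covering NON-nested pairs, and the named matrix as two parameter laws.
No hardware or vendor claims.
-/

namespace Summit.Ventures.CertifiedArithmetic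

open Literature.ComputerArithmetic.FloatingPoint
open Literature.ComputerArithmetic.FloatingPoint.Format
open Literature.ComputerArithmetic.FloatingPoint.MiniFloat

/-! ## §1 The surrogate of a root lies in the common normal band -/

/-- `(2^m q_θ)² ≤ q_φ` when `2 (m + L_θ) ≤ L_φ`. [folklore] -/
theorem pow_mul_quantum_sq_le_quantum {θ φ : Format}
    (h : 2 * ((θ.manBits : ℤ) + θ.qexp) ≤ φ.qexp) : (2 ^ θ.manBits * θ.quantum) ^ 2 ≤ φ.quantum := by
  have h2 : (2 : ℚ) ≠ 0 := by norm_num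
  have e : (2 : ℚ) ^ θ.manBits * θ.quantum = (2 : ℚ) ^ ((θ.manBits : ℤ) + θ.qexp) := by
    unfold Format.quantum; rw [zpow_add₀ h2, zpow_natCast]
  rw [e, sq, ← zpow_add₀ h2]
  unfold Format.quantum
  exact zpow_le_zpow_right₀ (by norm_num) (by omega)

/-- LOWER BAND END: if `L_χ ≤ L_θ` and `(2^m q_θ)² ≤ c`, the `χ`-surrogate of `√c` is at least
`2^m q_θ` (a multiple of the half quantum of `χ` whose square is below `c` lies below the root's
cell). [this packet] -/
theorem pow_mul_quantum_le_sqrtSurr {θ χ : Format} (hq : χ.qexp ≤ θ.qexp) {c : ℚ}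
    (h : (2 ^ θ.manBits * θ.quantum) ^ 2 ≤ c) : 2 ^ θ.manBits * θ.quantum ≤ sqrtSurr χ c := by
  have hν : 0 < χ.quantum / 2 := by have := χ.quantum_pos; positivity
  obtain ⟨D, hD⟩ : ∃ D : ℕ, θ.quantum = 2 ^ D * χ.quantum := ⟨_, quantum_eq_two_pow_mul hq⟩
  have hK : ((2 ^ (θ.manBits + D + 1) : ℕ) : ℚ) * (χ.quantum / 2) = 2 ^ θ.manBits * θ.quantum := by
    rw [hD]; push_cast; ring
  have hKle : 2 ^ (θ.manBits + D + 1) ≤ sqrtCell χ c := le_sqrtCell_of_sq_le (by rw [hK]; exact h)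
  calc (2 : ℚ) ^ θ.manBits * θ.quantum = ((2 ^ (θ.manBits + D + 1) : ℕ) : ℚ) * (χ.quantum / 2) :=
        hK.symm
    _ ≤ (sqrtCell χ c : ℚ) * (χ.quantum / 2) :=
        mul_le_mul_of_nonneg_right (by exact_mod_cast hKle) hν.le
    _ ≤ sqrtSurr χ c := sqrtCell_mul_le_sqrtSurr c

/-- UPPER BAND END: if `L_χ ≤ L_θ`, `0 ≤ c` and `c < M_θ²`, the `χ`-surrogate of `√c` is at most
`M_θ` (`(h ν)² ≤ c < M_θ²` gives `h ν < M_θ`, a multiple of `ν`, hence `(h+1) ν ≤ M_θ`).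
[this packet] -/
theorem sqrtSurr_le_maxRat {θ χ : Format} (hq : χ.qexp ≤ θ.qexp) {c : ℚ} (hc : 0 ≤ c)
    (h : c < θ.maxRat ^ 2) : sqrtSurr χ c ≤ θ.maxRat := by
  have hν : 0 < χ.quantum / 2 := by have := χ.quantum_pos; positivity
  obtain ⟨D, hD⟩ : ∃ D : ℕ, θ.quantum = 2 ^ D * χ.quantum := ⟨_, quantum_eq_two_pow_mul hq⟩
  have hN : θ.maxRat = ((θ.maxScaled * 2 ^ (D + 1) : ℕ) : ℚ) * (χ.quantum / 2) := by
    unfold Format.maxRat; rw [hD]; push_cast; ring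
  have hM0 : 0 ≤ θ.maxRat := by rw [hN]; positivity
  have hcell : ((sqrtCell χ c : ℚ) * (χ.quantum / 2)) ^ 2 ≤ c := sqrtCell_sq_le hc
  have hlt : (sqrtCell χ c : ℚ) * (χ.quantum / 2) < θ.maxRat :=
    lt_of_pow_lt_pow_left₀ 2 hM0 (lt_of_le_of_lt hcell h)
  rw [hN] at hlt
  have hlt' : sqrtCell χ c < θ.maxScaled * 2 ^ (D + 1) := by
    exact_mod_cast lt_of_mul_lt_mul_right hlt hν.le
  calc sqrtSurr χ c ≤ ((sqrtCell χ c : ℚ) + 1) * (χ.quantum / 2) := (sqrtSurr_lt c).le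
    _ ≤ ((θ.maxScaled * 2 ^ (D + 1) : ℕ) : ℚ) * (χ.quantum / 2) :=
        mul_le_mul_of_nonneg_right (by exact_mod_cast hlt') hν.le
    _ = θ.maxRat := hN.symm

/-- THE CORE: under the hypotheses of THEOREM E-sqrt, for a value `a > 0` of `φ` and a format `χ`
at least as fine as both, `fl_φ (fl_ψ x) = fl_φ x` at the `χ`-surrogate `x` of `√a` — it lies in
the common normal band of `φ` and `ψ`. [this packet] -/
theorem roundNE_roundNE_sqrtSurr_of_equal_precision {φ ψ χ : Format}
    (hm : φ.manBits = ψ.manBits) (h1 : 1 ≤ φ.manBits) (hχφ : χ.qexp ≤ φ.qexp)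
    (hχψ : χ.qexp ≤ ψ.qexp) (hloφ : 2 * ((φ.manBits : ℤ) + φ.qexp) ≤ φ.qexp)
    (hloψ : 2 * ((ψ.manBits : ℤ) + ψ.qexp) ≤ φ.qexp) (hone : 1 < φ.maxRat)
    (hhi : φ.maxRat < ψ.maxRat ^ 2) {a : MiniFloat φ} (ha : 0 < a.toRat) :
    (roundNE φ (roundNE ψ (sqrtSurr χ a.toRat)).toRat).toRat
      = (roundNE φ (sqrtSurr χ a.toRat)).toRat := by
  have hqa : φ.quantum ≤ a.toRat := by
    have := quantum_le_abs_toRat a ha.ne'; rwa [abs_of_pos ha] at this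
  have haM : a.toRat ≤ φ.maxRat := le_trans (le_abs_self _) (abs_toRat_le_maxRat a)
  have sqφ : (2 ^ φ.manBits * φ.quantum) ^ 2 ≤ a.toRat :=
    (pow_mul_quantum_sq_le_quantum hloφ).trans hqa
  have sqψ : (2 ^ ψ.manBits * ψ.quantum) ^ 2 ≤ a.toRat :=
    (pow_mul_quantum_sq_le_quantum hloψ).trans hqa
  have hφ2 : a.toRat < φ.maxRat ^ 2 := lt_of_le_of_lt haM (by nlinarith)
  have hψ2 : a.toRat < ψ.maxRat ^ 2 := lt_of_le_of_lt haM hhi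
  have hx0 : 0 ≤ sqrtSurr χ a.toRat := sqrtSurr_nonneg _
  apply toRat_roundNE_roundNE_of_manBits_eq_band hm h1 <;> rw [abs_of_nonneg hx0]
  · exact pow_mul_quantum_le_sqrtSurr hχφ sqφ
  · exact pow_mul_quantum_le_sqrtSurr hχψ sqψ
  · exact sqrtSurr_le_maxRat hχφ ha.le hφ2
  · exact sqrtSurr_le_maxRat hχψ ha.le hψ2

/-! ## §2 THEOREM E-sqrt -/

/-- THEOREM E-sqrt (EQUAL PRECISION, record-generic): if `m_φ = m_ψ = m ≥ 1`,
`2 (m + L_φ) ≤ L_φ`, `2 (m + L_ψ) ≤ L_φ`, `1 < M_φ` and `M_φ < M_ψ²`, then one square root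
executed in `ψ` and converted to `φ` is the correctly rounded square root of `φ` — no inclusion
between the value sets is asked. [this packet; cite: Figueroa1995, §2; cite: Roux2014, Thm 25;
cite: BoldoMelquiond2017, §3.1.3.4] -/
theorem drSqrt_of_equal_precision {φ ψ : Format} (hm : φ.manBits = ψ.manBits)
    (h1 : 1 ≤ φ.manBits) (hloφ : 2 * ((φ.manBits : ℤ) + φ.qexp) ≤ φ.qexp)
    (hloψ : 2 * ((ψ.manBits : ℤ) + ψ.qexp) ≤ φ.qexp) (hone : 1 < φ.maxRat)
    (hhi : φ.maxRat < ψ.maxRat ^ 2) : DRSqrt φ ψ := by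
  intro a ha
  rcases ha.eq_or_lt with h0 | hpos
  · unfold roundNESqrt
    rw [← h0, sqrtSurr_zero, sqrtSurr_zero, toRat_roundNE_zero, toRat_roundNE_zero]
  rcases le_total ψ.qexp φ.qexp with hq | hq
  · -- `ψ` is the finer format: both roots are roundings of the `ψ`-surrogate
    have key := roundNE_roundNE_sqrtSurr_of_equal_precision (χ := ψ) hm h1 hq le_rfl hloφ hloψ
      hone hhi hpos
    show (roundNE φ (roundNE ψ (sqrtSurr ψ a.toRat)).toRat).toRat = _
    rw [key]; exact toRat_roundNE_sqrtSurr hq ha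
  · -- `φ` is the finer format: both roots are roundings of the `φ`-surrogate
    have key := roundNE_roundNE_sqrtSurr_of_equal_precision (χ := φ) hm h1 le_rfl hq hloφ hloψ
      hone hhi hpos
    rw [← toRat_roundNE_sqrtSurr (φ := ψ) (ψ := φ) hq ha]
    exact key

/-- THEOREM E-sqrt AS A BOOLEAN TEST on parameter records. [this packet] -/
def drSqrtEqTest (φ ψ : Format) : Bool :=
  decide (φ.manBits = ψ.manBits) && decide (1 ≤ φ.manBits) &&
    decide (2 * ((φ.manBits : ℤ) + φ.qexp) ≤ φ.qexp) &&
    decide (2 * ((ψ.manBits : ℤ) + ψ.qexp) ≤ φ.qexp) &&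
    decide (1 < φ.maxRat) && decide (φ.maxRat < ψ.maxRat ^ 2)

/-- Soundness of the test. [this packet] -/
theorem drSqrt_of_eqTest {φ ψ : Format} (h : drSqrtEqTest φ ψ = true) : DRSqrt φ ψ := by
  simp only [drSqrtEqTest, Bool.and_eq_true, decide_eq_true_eq] at h
  obtain ⟨⟨⟨⟨⟨hm, h1⟩, hloφ⟩, hloψ⟩, hone⟩, hhi⟩ := h
  exact drSqrt_of_equal_precision hm h1 hloφ hloψ hone hhi

/-! ## §3 The named matrix without exhaustion -/

/-- The thirteen exhaustion cells of THEOREM D-sqrt all pass the equal-precision test.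
[this packet] -/
theorem drSqrtExhPairs_eqTest : ∀ p ∈ drSqrtExhPairs, drSqrtEqTest p.1 p.2 = true := by
  decide +kernel

/-- … hence are innocuous BY LAW (formerly `drSqrtExh`, exhaustion of the source). -/
theorem drSqrt_of_mem_exhPairs {X Y : Format} (h : (X, Y) ∈ drSqrtExhPairs) : DRSqrt X Y :=
  drSqrt_of_eqTest (drSqrtExhPairs_eqTest _ h)

/-- On the named records the equal-precision test holds on `25` cells: the `13` exhaustion cells,
the `2` (G) cells, and the `10` diagonal cells with `bias ≥ m + 1` (all but e2m1, e2m3,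
binary8p5). [this packet] -/
theorem drSqrtEqTest_named_cells :
    (∀ p ∈ namedPairs, drSqrtEqTest p.1 p.2 = true ↔
      (p ∈ drSqrtExhPairs ∨ p ∈ [(Binary8p3, Binary8p3F), (Binary8p4, Binary8p4F)] ∨
        (p.1 = p.2 ∧ p.1.manBits + 1 ≤ p.1.bias))) ∧
    (namedPairs.filter fun p => drSqrtEqTest p.1 p.2).length = 25 ∧
    (namedFormats.filter fun X => drSqrtEqTest X X) =
      [E3M2, E4M3, E5M2, Binary8p3, Binary8p4, Binary8p3F, Binary8p4F, Binary16, BFloat16,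
        Binary32] := by
  refine ⟨?_, ?_, ?_⟩ <;> decide +kernel

/-- THE MATRIX IS TWO TESTS: on the named pairs, `drSqrtPairs` is exactly the filter of
`drSqrtTest ∨ drSqrtEqTest` — no cell needs exhaustion (implementation B of the parameter law).
[this packet] -/
theorem drSqrtPairs_eq_filter_tests :
    drSqrtPairs = namedPairs.filter (fun p => drSqrtTest p.1 p.2 || drSqrtEqTest p.1 p.2) := by
  decide +kernel

/-- THEOREM D-sqrt ON THE NAMED FORMATS, LAW FORM: `DRSqrt X Y ↔ drSqrtTest X Y ∨
drSqrtEqTest X Y` — sufficiency by the two parameter laws (`drSqrt_of_test`,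
`drSqrt_of_eqTest`), necessity by the witness table of `DoubleRoundingSqrtMatrix.lean`.
[this packet] -/
theorem drSqrt_named_iff_tests {X Y : Format} (hX : X ∈ namedFormats) (hY : Y ∈ namedFormats) :
    DRSqrt X Y ↔ (drSqrtTest X Y || drSqrtEqTest X Y) = true := by
  constructor
  · intro h
    have hm := (drSqrt_named_iff hX hY).mp h
    rw [drSqrtPairs_eq_filter_tests, List.mem_filter] at hm
    exact hm.2
  · intro h
    rcases (Bool.or_eq_true _ _).mp h with ht | he
    · exact drSqrt_of_test ht
    · exact drSqrt_of_eqTest he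

/-- Sufficiency alone, exhaustion-free: every one of the `54` innocuous named cells follows from a
parameter law. [this packet] -/
theorem drSqrt_of_mem_drSqrtPairs {X Y : Format} (h : (X, Y) ∈ drSqrtPairs) : DRSqrt X Y := by
  rw [drSqrtPairs_eq_filter_tests, List.mem_filter, Bool.or_eq_true] at h
  exact h.2.elim drSqrt_of_test drSqrt_of_eqTest

/-- Among named pairs of EQUAL precision off the diagonal, (G) cells pass the equal-precision test
too and (S) never applies. [this packet] -/
theorem drSqrtTest_imp_eqTest_named : ∀ p ∈ namedPairs, p.1 ≠ p.2 → p.1.manBits = p.2.manBits →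
    drSqrtTest p.1 p.2 = true → drSqrtEqTest p.1 p.2 = true := by
  decide +kernel

/-- EQUAL PRECISION, NAMED: for named `X ≠ Y` with `m_X = m_Y`, one square root through `Y` is
innocuous for `X` IFF the equal-precision test holds — `15` of the `24` such pairs; the `9`
others (e5m2 / binary8p3 / binary8p3f → e3m2: `2 (m + L_Y) > L_X`; e2m3 → e4m3 / binary8p4 /
binary8p4f: `2 (m + L_X) > L_X`; e4m3 / binary8p4 / binary8p4f → e2m3: `2 (m + L_Y) > L_X`)
fail. [this packet] -/
theorem drSqrt_named_equal_precision_iff {X Y : Format} (hX : X ∈ namedFormats)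
    (hY : Y ∈ namedFormats) (hne : X ≠ Y) (hm : X.manBits = Y.manBits) :
    DRSqrt X Y ↔ drSqrtEqTest X Y = true := by
  rw [drSqrt_named_iff_tests hX hY, Bool.or_eq_true]
  exact ⟨fun h => h.elim (drSqrtTest_imp_eqTest_named _ (mem_namedPairs hX hY) hne hm) id,
    Or.inr⟩

/-- The counts: `24` off-diagonal named pairs of equal precision, `15` innocuous. -/
theorem drSqrt_named_equal_precision_counts :
    (namedPairs.filter fun p => decide (p.1 ≠ p.2 ∧ p.1.manBits = p.2.manBits)).length = 24 ∧
    (namedPairs.filter fun p =>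
      decide (p.1 ≠ p.2 ∧ p.1.manBits = p.2.manBits) && drSqrtEqTest p.1 p.2).length = 15 := by
  constructor <;> decide +kernel

/-! ## §4 Readings and the hypotheses (kernel instances; statements about the formats only) -/

/-- By law now: e4m3's roots through binary8p4 and conversely — value sets nested in neither
direction —, e5m2's through binary8p3, e3m2's through e5m2. -/
example : DRSqrt E4M3 Binary8p4 ∧ DRSqrt Binary8p4 E4M3 ∧ DRSqrt E5M2 Binary8p3 ∧
    DRSqrt E3M2 E5M2 ∧ ¬ Embeds E4M3 Binary8p4 ∧ ¬ Embeds Binary8p4 E4M3 :=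
  ⟨drSqrt_of_eqTest (by decide +kernel), drSqrt_of_eqTest (by decide +kernel),
    drSqrt_of_eqTest (by decide +kernel), drSqrt_of_eqTest (by decide +kernel),
    fun h => absurd ((embeds_named_iff (by decide) (by decide)).mp h) (by decide +kernel),
    fun h => absurd ((embeds_named_iff (by decide) (by decide)).mp h) (by decide +kernel)⟩

/-- The six clauses of `drSqrtEqTest`, separately: `[m_φ = m_ψ, 1 ≤ m, 2 (m + L_φ) ≤ L_φ,
2 (m + L_ψ) ≤ L_φ, 1 < M_φ, M_φ < M_ψ²]`. -/
def drSqrtEqClauses (φ ψ : Format) : List Bool :=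
  [decide (φ.manBits = ψ.manBits), decide (1 ≤ φ.manBits),
    decide (2 * ((φ.manBits : ℤ) + φ.qexp) ≤ φ.qexp),
    decide (2 * ((ψ.manBits : ℤ) + ψ.qexp) ≤ φ.qexp), decide (1 < φ.maxRat),
    decide (φ.maxRat < ψ.maxRat ^ 2)]

/-- The test is the conjunction of its six clauses. -/
theorem drSqrtEqTest_eq_all (φ ψ : Format) : drSqrtEqTest φ ψ = (drSqrtEqClauses φ ψ).all id := by
  simp only [drSqrtEqTest, drSqrtEqClauses, List.all_cons, List.all_nil, id, Bool.and_true,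
    Bool.and_assoc]

/-- A pseudo-record with e4m3's precision, bias `5` (`L = -7`) and top `1920`. -/
def M3Bias5 : Format := ⟨3, 5, 15, 7, by decide⟩

/-- A pseudo-record with e4m3's precision, bias `12` (`L = -14`) and top `15`. -/
def M3Bias12 : Format := ⟨3, 12, 15, 7, by decide⟩

/-- THE THREE RANGE HYPOTHESES ARE EACH NEEDED (given equal precision `m ≥ 1`): e4m3 through
`M3Bias5` violates only `2 (m + L_ψ) ≤ L_φ` and slips at `a = 2^-9` (root `≈ 0.0442` subnormal
in `M3Bias5`: `→ 6·2^-7 = 0.046875`, direct `11·2^-8`); e2m3 through binary8p4 violates only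
`2 (m + L_φ) ≤ L_φ` and slips at e2m3's subnormal `a = 7/8` (`√a ≈ 0.9354 → 15/16 → 1` by a
tie, direct `7/8`); e4m3 through `M3Bias12` violates only `M_φ < M_ψ²` and slips at `a = 256`
(`√256 = 16` saturates to `15`). Implementation A: `sqrt_equal_law.py` Part 4. [this packet] -/
theorem drSqrtEqTest_hypotheses_needed :
    (drSqrtEqClauses E4M3 M3Bias5 = [true, true, true, false, true, true] ∧
      ¬ DRSqrt E4M3 M3Bias5) ∧
    (drSqrtEqClauses E2M3 Binary8p4 = [true, true, false, true, true, true] ∧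
      ¬ DRSqrt E2M3 Binary8p4) ∧
    (drSqrtEqClauses E4M3 M3Bias12 = [true, true, true, true, true, false] ∧
      ¬ DRSqrt E4M3 M3Bias12) :=
  ⟨⟨by decide +kernel, not_drSqrt_of_ne (1 / 512) (by norm_num) (by decide +kernel)⟩,
    ⟨by decide +kernel, not_drSqrt_of_ne (7 / 8) (by norm_num) (by decide +kernel)⟩,
    ⟨by decide +kernel, not_drSqrt_of_ne 256 (by norm_num) (by decide +kernel)⟩⟩

/-- The 19-bit record with binary16's precision (`m = 10`) behind an 8-bit exponent field
(`bias 127`, codes `0 … 254`): `L = -136`, `M = (2 - 2^-10) · 2^127`. [this packet] -/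
def Binary16X8 : Format := ⟨10, 127, 254, 2 ^ 10 - 1, by decide⟩

/-- binary16's square roots are correctly emulated by ONE square root in `Binary16X8` converted
back (equal precision, binary16's normal range inside the wide one: the law), but not conversely:
the `Binary16X8` value `1601 · 2^-56` has root `≈ 5.0016 · 2^-25`, which binary16 rounds to its
SUBNORMAL `3 · 2^-24` (exact in `Binary16X8`) while `Binary16X8` rounds it to `5 · 2^-25`.
Implementation A: `sqrt_equal_law.py` Part 3 (brute force over binary16's `31744` nonnegative
values; the converse witness). [this packet] -/
theorem drSqrt_Binary16_exponent8 : DRSqrt Binary16 Binary16X8 ∧ ¬ DRSqrt Binary16X8 Binary16 :=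
  ⟨drSqrt_of_eqTest (by decide +kernel),
    not_drSqrt_of_ne (1601 / 2 ^ 56) (by norm_num) (by decide +kernel)⟩

end Summit.Ventures.CertifiedArithmetic
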